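import Literature.AnabelianGeometry.EtaleTheta.ContH1Lemmas
import Mathlib.GroupTheory.Index
import HarnessLib

/-!
# Level sets of continuous 1-cocycles: the subgroup on which a cocycle takes values in `B`

Neukirch–Schmidt–Wingberg, *Cohomology of Number Fields*, I §2 (crossed homomorphisms)
[cite: NeukirchSchmidtWingberg2008, I §2 and II §7]; used for Mochizuki, *The étale theta
function …*, Publ. RIMS **45** (2009), §2 p. 41 (PRIMS PDF): "it is a tautology that, upon
restriction to the covering `Ÿ̲̲ → Ÿ` … the class `η̈^Θ` determines a class
`η̲̈^Θ ∈ H¹(Π^tp_Ÿ̲̲, l·Δ_Θ)`" [cite: MochizukiEtTh2009, Def 2.7 p.41].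

Cell abc-iut, layer L2, item N3 (the choice `X̲̲`, stage 2 file A; seat abc-iut-L2-t7). For a
continuous 1-cocycle `f : H → A` (the tree's `contCocycles φ A H`, `ContH1.lean`: `G` acting on the
abelian normal subgroup `A ≤ G'` by conjugation through `φ`) and a subgroup `B ≤ G'` that is NORMAL
in `G'` (so stable under the action), the LEVEL SET `{h ∈ H | f h ∈ B}` is a SUBGROUP of `H`
(`levelSet`; the cocycle identity `f(gh) = f(g) · ᵍf(h)`), closed when `B` is closed, and its index
is at most `[A : A ∩ B]`: the cosets of the level set inject into `A/(A ∩ B)` via `h ↦ f(h)`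
(`relIndex … ` bookkeeping `index_levelSet_le`). With `B = ⊥` this is the ZERO SET of `f`. This is
how a Kummer-type covering is read off a cohomology class inside the group: in [EtTh] §2 the
covering `Ÿ̲̲ → Ÿ` on which `η̈^Θ` becomes `l·Δ_Θ`-valued (p. 41) is the level set of a
representative of `η̈^Θ` for `B = l·Δ_Θ`. Generic, input-free; nothing here concerns any disputed
claim.
-/

namespace Literature.AnabelianGeometry.EtaleTheta

namespace ContH1

variable {G G' : Type*} [Group G] [TopologicalSpace G]
  [Group G'] [TopologicalSpace G'] [IsTopologicalGroup G']
  {φ : G →* G'} {A : Subgroup G'} [A.Normal] [IsMulCommutative A] {H : Subgroup G}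

/-- **The level set of a cocycle**: `{h ∈ H | f(h) ∈ B}` for a normal subgroup `B ⊴ G'` — a
subgroup of `H`, since `f(gh) = f(g) · φ(g) f(h) φ(g)⁻¹` and `B` is stable under conjugation. For
`B = ⊥` the zero set of `f`; for [EtTh] p. 41, `B = l·Δ_Θ` and `f` a representative of `η̈^Θ` give
`Π^tp_Ÿ̲̲`. [cite: MochizukiEtTh2009, Def 2.7 p.41] -/
def levelSet (f : contCocycles φ A H) (B : Subgroup G') [B.Normal] : Subgroup H where
  carrier := {h | (f.1 h : G') ∈ B}
  one_mem' := by
    change ((f.1 1 : A) : G') ∈ B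
    rw [cocycle_map_one]
    exact one_mem B
  mul_mem' {g h} hg hh := by
    change ((f.1 (g * h) : A) : G') ∈ B
    rw [f.2.2 g h, Subgroup.coe_mul, MulAut.conjNormal_apply]
    exact mul_mem hg (Subgroup.Normal.conj_mem inferInstance _ hh _)
  inv_mem' {h} hh := by
    change ((f.1 h⁻¹ : A) : G') ∈ B
    have e : f.1 h⁻¹ = (MulAut.conjNormal (φ ((h⁻¹ : H) : G)) (f.1 h))⁻¹ := by
      have h2 := f.2.2 h⁻¹ h
      rw [inv_mul_cancel, cocycle_map_one] at h2
      exact eq_inv_of_mul_eq_one_left h2.symm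
    rw [e, Subgroup.coe_inv, MulAut.conjNormal_apply]
    exact inv_mem (Subgroup.Normal.conj_mem inferInstance _ hh _)

/-- Membership in the level set. [cite: MochizukiEtTh2009, Def 2.7 p.41] -/
theorem mem_levelSet_iff (f : contCocycles φ A H) (B : Subgroup G') [B.Normal] (h : H) :
    h ∈ levelSet f B ↔ (f.1 h : G') ∈ B :=
  Iff.rfl

/-- The level set for `B = ⊤` is everything. [cite: MochizukiEtTh2009, Def 2.7 p.41] -/
theorem levelSet_top (f : contCocycles φ A H) : levelSet f (⊤ : Subgroup G') = ⊤ :=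
  eq_top_iff.2 fun _ _ => Subgroup.mem_top _

/-- Level sets are monotone in `B`. [cite: MochizukiEtTh2009, Def 2.7 p.41] -/
theorem levelSet_mono (f : contCocycles φ A H) {B₁ B₂ : Subgroup G'} [B₁.Normal] [B₂.Normal]
    (hB : B₁ ≤ B₂) : levelSet f B₁ ≤ levelSet f B₂ :=
  fun _ hh => hB hh

/-- The level set of a cocycle is CLOSED when `B` is closed (`f` is continuous).
[cite: MochizukiEtTh2009, Def 2.7 p.41] -/
theorem isClosed_levelSet (f : contCocycles φ A H) (B : Subgroup G') [B.Normal]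
    (hB : IsClosed (B : Set G')) : IsClosed (levelSet f B : Set H) := by
  have hc : Continuous fun h : H => ((f.1 h : A) : G') := continuous_subtype_val.comp f.2.1
  exact hB.preimage hc

/-- The level set of a cocycle is OPEN when `B` is open. [cite: MochizukiEtTh2009, Def 2.7 p.41] -/
theorem isOpen_levelSet (f : contCocycles φ A H) (B : Subgroup G') [B.Normal]
    (hB : IsOpen (B : Set G')) : IsOpen (levelSet f B : Set H) := by
  have hc : Continuous fun h : H => ((f.1 h : A) : G') := continuous_subtype_val.comp f.2.1
  exact hB.preimage hc

/-- Two elements lie in the same left coset of the level set iff the cocycle takes values in the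
same coset of `B` at them: `g⁻¹h ∈ levelSet ⇔ f(g)⁻¹ f(h) ∈ B` (as `f(g⁻¹h) = φ(g)⁻¹ (f(g)⁻¹ f(h)) φ(g)`).
[cite: MochizukiEtTh2009, Def 2.7 p.41] -/
theorem inv_mul_mem_levelSet_iff (f : contCocycles φ A H) (B : Subgroup G') [B.Normal] (g h : H) :
    g⁻¹ * h ∈ levelSet f B ↔ ((f.1 g : G')⁻¹ * (f.1 h : G')) ∈ B := by
  rw [mem_levelSet_iff, f.2.2 g⁻¹ h]
  have e : f.1 g⁻¹ = (MulAut.conjNormal (φ ((g⁻¹ : H) : G)) (f.1 g))⁻¹ := by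
    have h2 := f.2.2 g⁻¹ g
    rw [inv_mul_cancel, cocycle_map_one] at h2
    exact eq_inv_of_mul_eq_one_left h2.symm
  rw [e, ← map_inv, ← map_mul, Subgroup.coe_inv, map_inv, MulAut.conjNormal_apply, Subgroup.coe_mul,
    Subgroup.coe_inv]
  -- `φ g⁻¹ · x · φ g ∈ B ↔ x ∈ B` for the normal subgroup `B`
  constructor
  · intro hx
    have := Subgroup.Normal.conj_mem inferInstance _ hx (φ (g : G))
    simpa [mul_assoc] using this
  · intro hx
    have := Subgroup.Normal.conj_mem inferInstance _ hx (φ (g : G))⁻¹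
    simpa [mul_assoc] using this

/-- **Index bound**: the left cosets of the level set inject into `A/(B ∩ A)` via `h ↦ f(h)`, so
`[H : levelSet f B] ≤ [A : B ∩ A]` whenever the latter is finite (e.g. `[Π^tp_Ÿ : Π^tp_Ÿ̲̲] ≤
[Δ_Θ : l·Δ_Θ] = l`, p. 41). [cite: MochizukiEtTh2009, Def 2.7 p.41] -/
theorem index_levelSet_le (f : contCocycles φ A H) (B : Subgroup G') [B.Normal]
    (hfin : ((B.subgroupOf A)).index ≠ 0) :
    (levelSet f B).index ≤ (B.subgroupOf A).index := by
  classical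
  -- the map on coset spaces `H / levelSet → A / (B ⊓ A)`, `[h] ↦ [f h]`
  let ψ : H ⧸ levelSet f B → A ⧸ B.subgroupOf A := Quotient.map' (fun h => f.1 h) fun g h hgh => by
    rw [QuotientGroup.leftRel_apply] at hgh ⊢
    rw [Subgroup.mem_subgroupOf, Subgroup.coe_mul, Subgroup.coe_inv]
    exact (inv_mul_mem_levelSet_iff f B g h).1 hgh
  have hinj : Function.Injective ψ := by
    intro x y
    induction x using Quotient.inductionOn' with | h g => ?_
    induction y using Quotient.inductionOn' with | h h => ?_
    intro hxy
    have hxy' : (QuotientGroup.mk (f.1 g) : A ⧸ B.subgroupOf A) = QuotientGroup.mk (f.1 h) := hxy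
    rw [QuotientGroup.eq, Subgroup.mem_subgroupOf, Subgroup.coe_mul, Subgroup.coe_inv] at hxy'
    change (QuotientGroup.mk g : H ⧸ levelSet f B) = QuotientGroup.mk h
    rw [QuotientGroup.eq]
    exact (inv_mul_mem_levelSet_iff f B g h).2 hxy'
  haveI : Finite (A ⧸ B.subgroupOf A) := Nat.finite_of_card_ne_zero hfin
  exact Nat.card_le_card_of_injective ψ hinj

/-- Restricting the cocycle to `H₁ ≤ H` restricts the level set: `levelSet (res f) B =
levelSet f B ∩ H₁`. [cite: MochizukiEtTh2009, Def 2.7 p.41] -/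
theorem mem_levelSet_resCocycle_iff {H₁ : Subgroup G} (hle : H₁ ≤ H) (f : contCocycles φ A H)
    (B : Subgroup G') [B.Normal] (h : H₁) :
    h ∈ levelSet (resCocycle φ A hle f) B ↔ (⟨h.1, hle h.2⟩ : H) ∈ levelSet f B :=
  Iff.rfl

/-- Multiplying the cocycle by a cocycle with values in `B` does not change the level set.
[cite: MochizukiEtTh2009, Def 2.7 p.41] -/
theorem levelSet_mul_of_forall_mem (f g : contCocycles φ A H) (B : Subgroup G') [B.Normal]
    (hg : ∀ h, (g.1 h : G') ∈ B) : levelSet (f * g) B = levelSet f B := by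
  ext h
  rw [mem_levelSet_iff, mem_levelSet_iff]
  change (((f.1 * g.1) h : A) : G') ∈ B ↔ _
  rw [Pi.mul_apply, Subgroup.coe_mul]
  constructor
  · intro hfg
    have := mul_mem hfg (inv_mem (hg h))
    simpa using this
  · intro hf
    exact mul_mem hf (hg h)

end ContH1

end Literature.AnabelianGeometry.EtaleTheta
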